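import Summits.BirchSwinnertonDyer.BirchSwinnertonDyer.Theorems.ManinLocalTwoThreeManinPrimeToAdditiveFiveLeReducibleTwistTransport
import Summits.BirchSwinnertonDyer.BirchSwinnertonDyer.Theorems.ManinLocalTwoThreeManinPrimeToAdditiveFiveLeLedgerSharpThirteen
import Summits.BirchSwinnertonDyer.Rank1Residual.Additive.GordKodairaType
import Literature.NumberTheory.EllipticCurves.Rank1Residual.GVParityTwistTransportProofs
import Literature.NumberTheory.EllipticCurves.IrreducibleModPQuadraticTwistProofs
import HarnessLib

/-!
# Route `ManinLocalTwoThree`, residual crux C5 `ManinPrimeToAdditiveFiveLe`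
# (stmt-BirchSwinnertonDyer-22969), line `upper_anchor` (skeleton v4, registered stub `stub_red57sharp`):
# **the reducible core RED(57)♯ SPLIT by Kodaira type — the starred half follows from the unstarred half
# by the irreducibility-free twist transport, up to the «bi-starred orbit» corner**

Piece θ (part 2 of 2) of the width seat (HOME STATUS 2026-08-28, after the lead's DONE 08:13:39Z).
RED(57)♯ (= `stub_red57sharp`): on globally twist-minimal classes with a conductor-level lattice-optimal
datum `D`, `p ∈ {5,7}`, `E[p]` reducible, `p² ∣ N(W) > 5·10⁵`, `p ∣ deg φ`, no `Iₙ*` fibre at `p` ⟹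
`p ∤ c(D)`. By Tate's algorithm at an additive `p ≥ 5` the fibre is then UNSTARRED (II/III/IV,
`ord_p Δ_min ≤ 4`) or STARRED (IV*/III*/II*, `ord_p Δ_min ∈ {8,9,10}`), and `χ_{p*}` exchanges the two.

* `coreRED57sharp_of_cns_of_unstarred_of_bistarred` — **RED(57)♯ ⟸ ČNS ∧ RED(57)♯[`ord_p Δ_min ≤ 4`]
  ∧ RED(57)♯[`ord_p Δ_min > 4` ∧ every lattice-optimal globally minimal curve isogenous to `W ⊗ χ_{p*}`
  is starred too]**: a starred `W` off that corner has an UNSTARRED lattice-optimal `W₀ ∼ W ⊗ χ_{p*}`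
  (datum `D₀`); then `W ∼ W₀ ⊗ χ_{p*}`, `p² ∣ N(W₀)` (twist-minimality of `W` at `p`), `N(W₀) = N(W)`
  (`conductorNorm_eq_of_isIsogenous_twist_pStar_of_sq_dvd`), the binders of RED(57)♯ transfer to `W₀`
  (part 1 §3; reducibility by `not_hasIrreducibleModPGaloisRep_of_isIsogenous` and
  `hasIrreducibleModPGaloisRep_quadraticTwist_iff`; no `Iₙ*` since `ord_p Δ_min(W₀) ≤ 4`), so `p ∤ c(D₀)`
  by the unstarred core (or by ČNS when `p ∤ deg φ₀`), and `c(D) ∣ c(D₀)` (part 1 §2).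
* `maninPrimeToAdditiveFiveLe_of_kato57_print_mazurJ_of_kp57_of_splitCores` — **C5 BY NAME ⟸ {F″, ČNS,
  Cremona ≤ 5·10⁵, EdK, EdG, MazurJ} ∧ KP57 ∧ RED(57)♯[unstarred] ∧ RED(57)♯[bi-starred] ∧ RED(13)♯**
  (p615677 ∘ the split).

WHY IT MATTERS. The «bi-starred orbit» corner (both optimal curves of a `χ_{p*}`-orbit of reducible
classes starred; then each is `p`-isogenous to the twist of the other and the two optimal degrees are
equal) is the only place where the starred half of RED(57)♯ is not carried by the unstarred half, and it
is EMPTY in Cremona's range: in the cell's two-engine twist census (`data/TWISTCENSUS2-rows-v1.tsv.gz`,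
sha256 43352cbe…, every class with `N ≤ 5·10⁵`, `p² ∣ N`, `d = p*`) the same-conductor `χ_{p*}`-orbits
with a rational `p`-isogeny number, by (`ord_p Δ_min` of the optimal curve, of the partner class's optimal
curve): `p = 5` — (low, low) 1 542 flip rows, (low, up) 377, (up, low) 377, **(up, up) 0**; `p = 7` —
(low, low) 122 flip rows + 54 CM self-twists, (low, up) 155, (up, low) 155, **(up, up) 0**. So in range
EVERY starred reducible optimal curve has an unstarred optimal partner (the transport applies), exactly
as at `p = 3` (MEMO-imc §19.15: the optimal member of every reducible III/III* class is the III one,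
7 402/7 402). Off that corner the live reducible core of C5 at `p ∈ {5, 7}` is Kodaira II/III/IV — the same
shape as Edixhoven's printed exception at `p ≥ 11`.

HONEST STATUS: conditional-result (`--supports … --as helper`); a reduction between OPEN cores; closes
nothing. Nothing here proves BSD, Manin's conjecture or C5. Seat bsd-line-ml23-c5-p1-w2 (width prover,
gen 2).

References: [Stevens1989] Lemmas (5.2), (5.4); [CesnaviciusNeururerSaha2023] Thm. 1.2; [EdixhovenManin1991]
Prop. 2, Thm. 3; [SilvermanATAEC1994] IV Table 4.1; [Kato2004Asterisque] (8.1.3), Thm. 9.7; [Mazur1978] Thm. 1.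
-/

set_option autoImplicit false
-- the Theorems namespace of this sub repeats the summit name by design (D-0017 nested layout)
set_option linter.dupNamespace false

noncomputable section

open scoped Classical NumberField

namespace Summit.BirchSwinnertonDyer.BirchSwinnertonDyer.Theorems

open WeierstrassCurve IsDedekindDomain IsDedekindDomain.HeightOneSpectrum Rat.HeightOneSpectrum NumberField
  Literature.NumberTheory.EllipticCurves Literature.NumberTheory.EllipticCurves.ModularForms
  Literature.NumberTheory.EllipticCurves.Rank1Residual
  Literature.NumberTheory.DiophantineGeometry
  Summit.BirchSwinnertonDyer.Rank1Residual.ManinAdditive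
  Summit.BirchSwinnertonDyer.Rank1Residual.Additive
  Summit.BirchSwinnertonDyer.BirchSwinnertonDyer.Theses.EdixhovenFibreFiveSeven

/-! ## RED(57)♯ from its unstarred half and the bi-starred corner -/

/-- **RED(57)♯ (= registered `stub_red57sharp`) ⟸ ČNS ∧ RED(57)♯[unstarred] ∧ RED(57)♯[bi-starred].**
`hlow`: the core on `ord_p Δ_min ≤ 4` (Kodaira II/III/IV). `hB`: the core on `ord_p Δ_min > 4` (IV*/III*/II*,
the `Iₙ*` being excluded) under the extra clause «every lattice-optimal globally minimal curve isogenous to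
`W ⊗ χ_{p*}` has `ord_p Δ_min > 4` too». Proof: a starred `W` off the corner has an UNSTARRED
lattice-optimal `W₀ ∼ W ⊗ χ_{p*}` with datum `D₀`; then `W ∼ W₀ ⊗ χ_{p*}`, `p² ∣ N(W₀)` (twist-minimality
of `W` at `p`), `N(W₀) = N(W)` (`conductorNorm_eq_of_isIsogenous_twist_pStar_of_sq_dvd`), the binders of
RED(57)♯ transfer to `W₀` (part 1 §3; reducibility by `not_hasIrreducibleModPGaloisRep_of_isIsogenous` and
`hasIrreducibleModPGaloisRep_quadraticTwist_iff`; no `Iₙ*` since `ord_p Δ_min(W₀) ≤ 4`), so `p ∤ c(D₀)` by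
`hlow` (or by ČNS when `p ∤ deg φ₀`), and `c(D) ∣ c(D₀)` (part 1 §2). Conditional-result between OPEN cores.
[cite: Stevens1989, Lemmas (5.2), (5.4)] [cite: CesnaviciusNeururerSaha2023, Thm. 1.2]
[cite: SilvermanATAEC1994, IV Table 4.1] -/
theorem coreRED57sharp_of_cns_of_unstarred_of_bistarred
    (hCNS : cesnaviciusNeururerSaha_padicVal_maninConstant_le_modularDegree)
    (hlow : mazur_not_dvd_maninConstant_of_odd → abbesUllmo_not_dvd_maninConstant_of_not_dvd_level →
      cesnavicius_not_two_dvd_maninConstant_of_two_dvd_level → exists_isNewformOf →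
      ∀ (W : WeierstrassCurve ℚ) [W.IsElliptic] [W.IsGloballyMinimal] [NeZero (W.conductorNorm ℤ)]
        (D : ModularParametrizationData W (W.conductorNorm ℤ)),
        IsLatticeOptimal D → ∀ (p : ℕ) (hp : p.Prime), (p = 5 ∨ p = 7) → p ^ 2 ∣ W.conductorNorm ℤ →
        ¬ (∃ (W' : WeierstrassCurve ℚ) (q : ℕ), W'.IsElliptic ∧ W'.IsGloballyMinimal ∧ q.Prime ∧
            q ≠ 2 ∧ q ^ 2 ∣ W.conductorNorm ℤ ∧
            IsIsogenous W (W'.quadraticTwist (((-1 : ℤ) ^ (q / 2) * q : ℤ) : ℚ)) ∧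
            ¬ q ^ 2 ∣ W'.conductorNorm ℤ) →
        ¬ (∃ (W' : WeierstrassCurve ℚ) (d : ℤ), W'.IsElliptic ∧ W'.IsGloballyMinimal ∧
            (d = -1 ∨ d = 2 ∨ d = -2) ∧ 2 ^ 2 ∣ W.conductorNorm ℤ ∧
            IsIsogenous W (W'.quadraticTwist (d : ℚ)) ∧ ¬ 2 ^ 2 ∣ W'.conductorNorm ℤ) →
        ¬ W.HasIrreducibleModPGaloisRep p →
        500000 < W.conductorNorm ℤ →
        p ∣ D.modularDegree →
        (∀ n : ℕ, W.kodairaSymbolAt ((Rat.HeightOneSpectrum.primesEquiv (R := ℤ)).symm ⟨p, hp⟩) ≠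
          .Istar n) →
        padicValInt p W.minimalDiscriminantInt ≤ 4 →
        ¬ (p : ℤ) ∣ D.maninConstant)
    (hB : mazur_not_dvd_maninConstant_of_odd → abbesUllmo_not_dvd_maninConstant_of_not_dvd_level →
      cesnavicius_not_two_dvd_maninConstant_of_two_dvd_level → exists_isNewformOf →
      ∀ (W : WeierstrassCurve ℚ) [W.IsElliptic] [W.IsGloballyMinimal] [NeZero (W.conductorNorm ℤ)]
        (D : ModularParametrizationData W (W.conductorNorm ℤ)),
        IsLatticeOptimal D → ∀ (p : ℕ) (hp : p.Prime), (p = 5 ∨ p = 7) → p ^ 2 ∣ W.conductorNorm ℤ →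
        ¬ (∃ (W' : WeierstrassCurve ℚ) (q : ℕ), W'.IsElliptic ∧ W'.IsGloballyMinimal ∧ q.Prime ∧
            q ≠ 2 ∧ q ^ 2 ∣ W.conductorNorm ℤ ∧
            IsIsogenous W (W'.quadraticTwist (((-1 : ℤ) ^ (q / 2) * q : ℤ) : ℚ)) ∧
            ¬ q ^ 2 ∣ W'.conductorNorm ℤ) →
        ¬ (∃ (W' : WeierstrassCurve ℚ) (d : ℤ), W'.IsElliptic ∧ W'.IsGloballyMinimal ∧
            (d = -1 ∨ d = 2 ∨ d = -2) ∧ 2 ^ 2 ∣ W.conductorNorm ℤ ∧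
            IsIsogenous W (W'.quadraticTwist (d : ℚ)) ∧ ¬ 2 ^ 2 ∣ W'.conductorNorm ℤ) →
        ¬ W.HasIrreducibleModPGaloisRep p →
        500000 < W.conductorNorm ℤ →
        p ∣ D.modularDegree →
        (∀ n : ℕ, W.kodairaSymbolAt ((Rat.HeightOneSpectrum.primesEquiv (R := ℤ)).symm ⟨p, hp⟩) ≠
          .Istar n) →
        4 < padicValInt p W.minimalDiscriminantInt →
        (∀ (W₀ : WeierstrassCurve ℚ) [W₀.IsElliptic] [W₀.IsGloballyMinimal] [NeZero (W₀.conductorNorm ℤ)]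
            (D₀ : ModularParametrizationData W₀ (W₀.conductorNorm ℤ)), IsLatticeOptimal D₀ →
            IsIsogenous (W.quadraticTwist ((((-1 : ℤ) ^ (p / 2) * p : ℤ)) : ℚ)) W₀ →
            4 < padicValInt p W₀.minimalDiscriminantInt) →
        ¬ (p : ℤ) ∣ D.maninConstant) :
    mazur_not_dvd_maninConstant_of_odd → abbesUllmo_not_dvd_maninConstant_of_not_dvd_level →
    cesnavicius_not_two_dvd_maninConstant_of_two_dvd_level → exists_isNewformOf →
    ∀ (W : WeierstrassCurve ℚ) [W.IsElliptic] [W.IsGloballyMinimal] [NeZero (W.conductorNorm ℤ)]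
      (D : ModularParametrizationData W (W.conductorNorm ℤ)),
      IsLatticeOptimal D → ∀ (p : ℕ) (hp : p.Prime), (p = 5 ∨ p = 7) → p ^ 2 ∣ W.conductorNorm ℤ →
      ¬ (∃ (W' : WeierstrassCurve ℚ) (q : ℕ), W'.IsElliptic ∧ W'.IsGloballyMinimal ∧ q.Prime ∧
          q ≠ 2 ∧ q ^ 2 ∣ W.conductorNorm ℤ ∧
          IsIsogenous W (W'.quadraticTwist (((-1 : ℤ) ^ (q / 2) * q : ℤ) : ℚ)) ∧
          ¬ q ^ 2 ∣ W'.conductorNorm ℤ) →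
      ¬ (∃ (W' : WeierstrassCurve ℚ) (d : ℤ), W'.IsElliptic ∧ W'.IsGloballyMinimal ∧
          (d = -1 ∨ d = 2 ∨ d = -2) ∧ 2 ^ 2 ∣ W.conductorNorm ℤ ∧
          IsIsogenous W (W'.quadraticTwist (d : ℚ)) ∧ ¬ 2 ^ 2 ∣ W'.conductorNorm ℤ) →
      ¬ W.HasIrreducibleModPGaloisRep p →
      500000 < W.conductorNorm ℤ →
      p ∣ D.modularDegree →
      (∀ n : ℕ, W.kodairaSymbolAt ((Rat.HeightOneSpectrum.primesEquiv (R := ℤ)).symm ⟨p, hp⟩) ≠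
        .Istar n) →
      ¬ (p : ℤ) ∣ D.maninConstant := by
  intro hM hAU hC hnf W _ _ _ D hD p hp h57 hpN hodd hdy hred hN hdeg hI
  haveI hpF : Fact p.Prime := ⟨hp⟩
  have h5 : 5 ≤ p := by rcases h57 with rfl | rfl <;> norm_num
  have hp2 : p ≠ 2 := by omega
  by_cases hv : padicValInt p W.minimalDiscriminantInt ≤ 4
  · exact hlow hM hAU hC hnf W D hD p hp h57 hpN hodd hdy hred hN hdeg hI hv
  push Not at hv
  by_cases hall : ∀ (W₀ : WeierstrassCurve ℚ) [W₀.IsElliptic] [W₀.IsGloballyMinimal]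
      [NeZero (W₀.conductorNorm ℤ)] (D₀ : ModularParametrizationData W₀ (W₀.conductorNorm ℤ)),
      IsLatticeOptimal D₀ → IsIsogenous (W.quadraticTwist ((((-1 : ℤ) ^ (p / 2) * p : ℤ)) : ℚ)) W₀ →
      4 < padicValInt p W₀.minimalDiscriminantInt
  · exact hB hM hAU hC hnf W D hD p hp h57 hpN hodd hdy hred hN hdeg hI hv hall
  simp only [not_forall, not_lt, exists_prop] at hall
  obtain ⟨W₀, hE₀, hM₀, hne₀, D₀, hD₀, hiso, hv₀⟩ := hall
  -- `W ∼ W₀ ⊗ p*`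
  have hd0 : ((((-1 : ℤ) ^ (p / 2) * p : ℤ)) : ℚ) ≠ 0 := by
    push_cast
    exact mul_ne_zero (pow_ne_zero _ (by norm_num)) (by exact_mod_cast hp.ne_zero)
  haveI : (W.quadraticTwist ((((-1 : ℤ) ^ (p / 2) * p : ℤ)) : ℚ)).IsElliptic := W.isElliptic_quadraticTwist hd0
  haveI : (W₀.quadraticTwist ((((-1 : ℤ) ^ (p / 2) * p : ℤ)) : ℚ)).IsElliptic := W₀.isElliptic_quadraticTwist hd0
  haveI : ((W.quadraticTwist ((((-1 : ℤ) ^ (p / 2) * p : ℤ)) : ℚ)).quadraticTwist ((((-1 : ℤ) ^ (p / 2) * p : ℤ)) : ℚ)).IsElliptic :=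
    (W.quadraticTwist ((((-1 : ℤ) ^ (p / 2) * p : ℤ)) : ℚ)).isElliptic_quadraticTwist hd0
  have htw : IsIsogenous W (W₀.quadraticTwist ((((-1 : ℤ) ^ (p / 2) * p : ℤ)) : ℚ)) := by
    obtain ⟨Cq, hCq⟩ := W.exists_variableChange_smul_eq_quadraticTwist_sq hd0
    have h1 : IsIsogenous W ((W.quadraticTwist ((((-1 : ℤ) ^ (p / 2) * p : ℤ)) : ℚ)).quadraticTwist ((((-1 : ℤ) ^ (p / 2) * p : ℤ)) : ℚ)) := by
      rw [quadraticTwist_quadraticTwist, ← sq, ← hCq]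
      exact isIsogenous_smul _ _
    exact h1.trans' (hiso.quadraticTwist hd0)
  -- twist-minimality of `W` at `p`: `p² ∣ N(W₀)`; hence `N(W₀) = N(W)`
  have hpN₀ : p ^ 2 ∣ W₀.conductorNorm ℤ := by
    by_contra h
    exact hodd ⟨W₀, p, hE₀, hM₀, hp, hp2, hpN, htw, h⟩
  have hNN : W₀.conductorNorm ℤ = W.conductorNorm ℤ :=
    conductorNorm_eq_of_isIsogenous_twist_pStar_of_sq_dvd hnf h5 htw hpN hpN₀
  -- `p ∤ c(D₀)`
  have hv₀' : padicValInt p W₀.minimalDiscriminantInt < 6 := by omega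
  have h0 : ¬ (p : ℤ) ∣ D₀.maninConstant := by
    by_cases hdeg₀ : p ∣ D₀.modularDegree
    · have hred₀ : ¬ W₀.HasIrreducibleModPGaloisRep p := fun h ↦
        not_hasIrreducibleModPGaloisRep_of_isIsogenous htw hred
          ((hasIrreducibleModPGaloisRep_quadraticTwist_iff W₀ hd0 p).mpr h)
      have hadd₀ : Addv W₀ p := not_good_and_not_mult_of_sq_dvd_conductorNorm W₀ hpN₀
      have hI₀ : ∀ n : ℕ,
          W₀.kodairaSymbolAt ((Rat.HeightOneSpectrum.primesEquiv (R := ℤ)).symm ⟨p, hp⟩) ≠ .Istar n := by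
        intro n hn
        have hn' : W₀.kodairaSymbolAt (placeOf p) = .Istar n := hn
        rcases kodairaSymbolAt_placeOf_cases_of_addv W₀ p h5 hadd₀ with
          ⟨h, _⟩ | ⟨h, _⟩ | ⟨h, _⟩ | ⟨m, h, hm⟩ | ⟨h, _⟩ | ⟨h, _⟩ | ⟨h, _⟩
        · rw [hn'] at h; exact KodairaSymbol.noConfusion h
        · rw [hn'] at h; exact KodairaSymbol.noConfusion h
        · rw [hn'] at h; exact KodairaSymbol.noConfusion h
        · omega
        · rw [hn'] at h; exact KodairaSymbol.noConfusion h
        · rw [hn'] at h; exact KodairaSymbol.noConfusion h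
        · rw [hn'] at h; exact KodairaSymbol.noConfusion h
      exact hlow hM hAU hC hnf W₀ D₀ hD₀ p hp h57 hpN₀
        (oddTwistMinimal_of_isIsogenous_twist_pStar hnf hp2 htw hpN hNN hodd)
        (dyadicTwistMinimal_of_isIsogenous_twist_pStar hp2 htw hNN hdy)
        hred₀ (by rw [hNN]; exact hN) hdeg₀ hI₀ hv₀
    · exact not_dvd_maninConstant_of_not_dvd_modularDegree hCNS W₀ D₀ hp h5 hdeg₀
  -- transport `c(D) ∣ c(D₀)`
  have hdvd : D.c ∣ D₀.c :=
    maninConstant_dvd_of_isIsogenous_twist_pStar_of_padicValInt_lt_six hp2 W₀ W D₀ D hD hpN₀ hNN.symm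
      htw hv₀'
  exact fun h ↦ h0 (h.trans hdvd)

/-- **C5 `ManinPrimeToAdditiveFiveLe` BY NAME ⟸ six printed facts + KP57 + the SPLIT reducible cores**
(conditional-result, C5 is NOT proved): Kato F″, ČNS Thm. 1.2, Cremona ≤ 5·10⁵, Edixhoven Thm. 3 ×2,
Mazur's `X₀(p)` list; KP57 (stmt-BirchSwinnertonDyer-23810) BY NAME; RED(57)♯[unstarred] (`h57l`),
RED(57)♯[bi-starred] (`h57b`), RED(13)♯ (`h13s`). Proof: p615677 ∘ §4.
[cite: Kato2004Asterisque, (8.1.3) (p. 180), Thm. 9.7 (p. 189)] [cite: EdixhovenManin1991, Thm. 3]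
[cite: CesnaviciusNeururerSaha2023, Thm. 1.2 and §1 p. 2] [cite: Mazur1978, Thm. 1]
[cite: Stevens1989, Lemmas (5.2), (5.4)] -/
theorem maninPrimeToAdditiveFiveLe_of_kato57_print_mazurJ_of_kp57_of_splitCores
    (hK57 : kato_neron_isIntegral_twistedSymbolSum_of_additive_five_le)
    (hCNS : cesnaviciusNeururerSaha_padicVal_maninConstant_le_modularDegree)
    (h500k : cremona_abs_maninConstant_eq_one_of_level_le_500000)
    (hEdK : edixhoven_not_dvd_maninConstant_of_kodairaSymbol_ne)
    (hEdG : edixhoven_not_dvd_maninConstant_of_not_potentiallyGoodOrdinary)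
    (hJ : mazur_j_mem_of_not_hasIrreducibleModPGaloisRep_of_eleven_le)
    (hKP57 : KPResidueManinUnitFiveSeven)
    (h57l : mazur_not_dvd_maninConstant_of_odd → abbesUllmo_not_dvd_maninConstant_of_not_dvd_level →
      cesnavicius_not_two_dvd_maninConstant_of_two_dvd_level → exists_isNewformOf →
      ∀ (W : WeierstrassCurve ℚ) [W.IsElliptic] [W.IsGloballyMinimal] [NeZero (W.conductorNorm ℤ)]
        (D : ModularParametrizationData W (W.conductorNorm ℤ)),
        IsLatticeOptimal D → ∀ (p : ℕ) (hp : p.Prime), (p = 5 ∨ p = 7) → p ^ 2 ∣ W.conductorNorm ℤ →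
        ¬ (∃ (W' : WeierstrassCurve ℚ) (q : ℕ), W'.IsElliptic ∧ W'.IsGloballyMinimal ∧ q.Prime ∧
            q ≠ 2 ∧ q ^ 2 ∣ W.conductorNorm ℤ ∧
            IsIsogenous W (W'.quadraticTwist (((-1 : ℤ) ^ (q / 2) * q : ℤ) : ℚ)) ∧
            ¬ q ^ 2 ∣ W'.conductorNorm ℤ) →
        ¬ (∃ (W' : WeierstrassCurve ℚ) (d : ℤ), W'.IsElliptic ∧ W'.IsGloballyMinimal ∧
            (d = -1 ∨ d = 2 ∨ d = -2) ∧ 2 ^ 2 ∣ W.conductorNorm ℤ ∧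
            IsIsogenous W (W'.quadraticTwist (d : ℚ)) ∧ ¬ 2 ^ 2 ∣ W'.conductorNorm ℤ) →
        ¬ W.HasIrreducibleModPGaloisRep p →
        500000 < W.conductorNorm ℤ →
        p ∣ D.modularDegree →
        (∀ n : ℕ, W.kodairaSymbolAt ((Rat.HeightOneSpectrum.primesEquiv (R := ℤ)).symm ⟨p, hp⟩) ≠
          .Istar n) →
        padicValInt p W.minimalDiscriminantInt ≤ 4 →
        ¬ (p : ℤ) ∣ D.maninConstant)
    (h57b : mazur_not_dvd_maninConstant_of_odd → abbesUllmo_not_dvd_maninConstant_of_not_dvd_level →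
      cesnavicius_not_two_dvd_maninConstant_of_two_dvd_level → exists_isNewformOf →
      ∀ (W : WeierstrassCurve ℚ) [W.IsElliptic] [W.IsGloballyMinimal] [NeZero (W.conductorNorm ℤ)]
        (D : ModularParametrizationData W (W.conductorNorm ℤ)),
        IsLatticeOptimal D → ∀ (p : ℕ) (hp : p.Prime), (p = 5 ∨ p = 7) → p ^ 2 ∣ W.conductorNorm ℤ →
        ¬ (∃ (W' : WeierstrassCurve ℚ) (q : ℕ), W'.IsElliptic ∧ W'.IsGloballyMinimal ∧ q.Prime ∧
            q ≠ 2 ∧ q ^ 2 ∣ W.conductorNorm ℤ ∧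
            IsIsogenous W (W'.quadraticTwist (((-1 : ℤ) ^ (q / 2) * q : ℤ) : ℚ)) ∧
            ¬ q ^ 2 ∣ W'.conductorNorm ℤ) →
        ¬ (∃ (W' : WeierstrassCurve ℚ) (d : ℤ), W'.IsElliptic ∧ W'.IsGloballyMinimal ∧
            (d = -1 ∨ d = 2 ∨ d = -2) ∧ 2 ^ 2 ∣ W.conductorNorm ℤ ∧
            IsIsogenous W (W'.quadraticTwist (d : ℚ)) ∧ ¬ 2 ^ 2 ∣ W'.conductorNorm ℤ) →
        ¬ W.HasIrreducibleModPGaloisRep p →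
        500000 < W.conductorNorm ℤ →
        p ∣ D.modularDegree →
        (∀ n : ℕ, W.kodairaSymbolAt ((Rat.HeightOneSpectrum.primesEquiv (R := ℤ)).symm ⟨p, hp⟩) ≠
          .Istar n) →
        4 < padicValInt p W.minimalDiscriminantInt →
        (∀ (W₀ : WeierstrassCurve ℚ) [W₀.IsElliptic] [W₀.IsGloballyMinimal] [NeZero (W₀.conductorNorm ℤ)]
            (D₀ : ModularParametrizationData W₀ (W₀.conductorNorm ℤ)), IsLatticeOptimal D₀ →
            IsIsogenous (W.quadraticTwist ((((-1 : ℤ) ^ (p / 2) * p : ℤ)) : ℚ)) W₀ →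
            4 < padicValInt p W₀.minimalDiscriminantInt) →
        ¬ (p : ℤ) ∣ D.maninConstant)
    (h13s : mazur_not_dvd_maninConstant_of_odd → abbesUllmo_not_dvd_maninConstant_of_not_dvd_level →
      cesnavicius_not_two_dvd_maninConstant_of_two_dvd_level → exists_isNewformOf →
      ∀ (W : WeierstrassCurve ℚ) [W.IsElliptic] [W.IsGloballyMinimal] [NeZero (W.conductorNorm ℤ)]
        (D : ModularParametrizationData W (W.conductorNorm ℤ)),
        IsLatticeOptimal D → ∀ p : ℕ, p.Prime → p = 13 → p ^ 2 ∣ W.conductorNorm ℤ →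
        ¬ (∃ (W' : WeierstrassCurve ℚ) (q : ℕ), W'.IsElliptic ∧ W'.IsGloballyMinimal ∧ q.Prime ∧
            q ≠ 2 ∧ q ^ 2 ∣ W.conductorNorm ℤ ∧
            IsIsogenous W (W'.quadraticTwist (((-1 : ℤ) ^ (q / 2) * q : ℤ) : ℚ)) ∧
            ¬ q ^ 2 ∣ W'.conductorNorm ℤ) →
        ¬ (∃ (W' : WeierstrassCurve ℚ) (d : ℤ), W'.IsElliptic ∧ W'.IsGloballyMinimal ∧
            (d = -1 ∨ d = 2 ∨ d = -2) ∧ 2 ^ 2 ∣ W.conductorNorm ℤ ∧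
            IsIsogenous W (W'.quadraticTwist (d : ℚ)) ∧ ¬ 2 ^ 2 ∣ W'.conductorNorm ℤ) →
        ¬ W.HasIrreducibleModPGaloisRep p →
        padicValInt p W.minimalDiscriminantInt ≤ 4 →
        (∃ (L : Type) (_ : Field L) (_ : NumberField L) (_ : IsCyclotomicExtension {p} ℚ L)
            (F : IntermediateField ℚ L),
            ∀ w : HeightOneSpectrum (𝓞 F), (p : 𝓞 F) ∈ w.asIdeal →
              (W.baseChange F).HasGoodReductionAt w ∧ (W.baseChange F).HasUnitRootAt w) →
        p ∣ D.modularDegree →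
        500000 < W.conductorNorm ℤ →
        ¬ (p : ℤ) ∣ D.maninConstant) :
    Summit.BirchSwinnertonDyer.BirchSwinnertonDyer.Theses.ManinLocalTwoThree.ManinPrimeToAdditiveFiveLe :=
  maninPrimeToAdditiveFiveLe_of_kato57_print_mazurJ_of_kp57_of_sharpCores hK57 hCNS h500k hEdK hEdG hJ hKP57
    (coreRED57sharp_of_cns_of_unstarred_of_bistarred hCNS h57l h57b) h13s

end Summit.BirchSwinnertonDyer.BirchSwinnertonDyer.Theorems

end
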